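import Mathlib.Analysis.ODE.ExistUnique
import Mathlib.Analysis.Calculus.MeanValue
import Mathlib.Analysis.Calculus.Deriv.Prod
import Mathlib.Analysis.Calculus.Deriv.Pi
import Mathlib.Analysis.Calculus.ContDiff.RCLike
import HarnessLib

/-!
# Time-dependent invariant boxes (Müller–Nagumo face conditions): existence of trapped solutions

Topic `Literature/Analysis/ODE` (namespace `Literature.Analysis.ODE`). The finite-dimensional
"first-exit / trapping-region" argument in the form in which it is used by shell-model and Galerkin
constructions: a system `x' = F(t, x)` on `ℝ^ι` (`ι` finite, sup norm), a MOVING BOX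
`[ℓ(t), u(t)] = {x | ∀ i, ℓ t i ≤ x i ≤ u t i}` (`= Set.Icc (ℓ t) (u t)` in the product order) with
continuous, right-differentiable faces, and FACE CONDITIONS saying that the field does not let a
solution leave the box through a face. We prove EXISTENCE of a solution issued from a point of the box
that stays in the box on the whole time interval, in both time directions:

* `exists_solution_mem_Icc_of_face_backward` — terminal data `x b ∈ [ℓ b, u b]`; on the upper face
  `x i = u t i` the field satisfies `u' t i ≤ F t x i`, on the lower face `F t x i ≤ ℓ' t i` (so
  that, going BACKWARD in time, no coordinate can cross its face); conclusion: a solution on `[a, b]`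
  (`HasDerivWithinAt … (Icc a b)`, Mathlib's integral-curve convention) with `x t ∈ [ℓ t, u t]`
  for all `t ∈ [a, b]`.
* `exists_solution_mem_Icc_of_face_forward` — initial data at `a`, the mirror conditions
  `F t x i ≤ u' t i` on the upper face and `ℓ' t i ≤ F t x i` on the lower face (W. Müller's 1927
  conditions).

Hypotheses on `F`: jointly continuous on `[a, b] × ℝ^ι` and Lipschitz in `x` on each box `[ℓ t, u t]`
with one constant `K` (e.g. any field polynomial in `x` with coefficients continuous in `t`). The
face inequalities are NON-STRICT and are only required AT points of the box (all other coordinates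
between their barriers), exactly as in the printed trapping arguments; the faces need only RIGHT
derivatives (`HasDerivWithinAt … (Ici t)`), so barriers with finitely many kinks are admissible.

## Proof (clamping; cf. Deimling 1977, §5.2, and the retraction device of `PeanoExistence.lean`)

Let `π_t` be the coordinatewise clamp onto `[ℓ t, u t]` (`boxClamp`, 1-Lipschitz for the sup norm)
and `G(t, x) = F(t, π_t x)`. Then `G` is globally Lipschitz and bounded on `[a, b] × ℝ^ι`, so
Mathlib's Picard–Lindelöf theorem (`IsPicardLindelof.exists_eq_forall_mem_Icc_hasDerivWithinAt₀`,
applied on one large ball) gives a solution `α` of `α' = G(t, α)` on all of `[a, b]` — no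
continuation argument is needed. For each coordinate, `φ = α i − u i` satisfies: where `φ > 0`
(resp. `≥ 0`) the clamped point lies ON the upper face, so the face condition gives the sign of
`φ'`; the one-dimensional no-crossing lemmas (`nonpos_of_deriv_right_backward`,
`nonpos_of_deriv_right_forward`; Mathlib's fencing lemma
`image_le_of_deriv_right_le_deriv_boundary` on the maximal interval of positivity) give `φ ≤ 0`.
Hence `α` stays in the box, `π_t α = α`, and `α` solves the ORIGINAL equation.

What is NOT here: uniqueness / the statement that EVERY solution from the box stays inside (true
under the same Lipschitz hypothesis by Gronwall; not needed by the constructions this serves), and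
infinite-dimensional versions (Deimling 1977, Thm 5.2, needs a distance-set / convexity hypothesis).

## References

* K. Deimling, *Ordinary Differential Equations in Banach Spaces*, LNM 596, Springer 1977, §5.2
  "Flow invariance", Thm 5.1–5.2, pp. 67–68 (forward invariance of a closed set under the Nagumo
  subtangent condition for locally Lipschitz fields). Key `Deimling1977`.
* P. Hartman, *Ordinary Differential Equations*, SIAM Classics 38 (2002), Ch. III (differential
  inequalities). Key `Hartman2002`.
-/

noncomputable section

open Set Metric Filter Function
open scoped NNReal Topology

namespace Literature.Analysis.ODE

/-! ## One-dimensional no-crossing lemmas -/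

section OneDim

variable {φ φ' : ℝ → ℝ} {a b : ℝ}

/-- **Backward no-crossing.** Let `φ` be continuous on `[a, b]` with a right derivative `φ' t` at
every `t ∈ [a, b)`, `φ b ≤ 0`, and `0 ≤ φ' t` whenever `φ t > 0`. Then `φ ≤ 0` on `[a, b]`
(on a maximal interval `[t₁, t₂)` of positivity `φ` would be non-decreasing, contradicting
`φ t₂ ≤ 0 < φ t₁`). Localised (first-exit) form of Hartman's monotonicity lemma for functions with
a signed right derivative. [cite: Hartman2002, Ch. III §4 Cor 4.1 with Thm 4.1 Remark 1] -/
theorem nonpos_of_deriv_right_backward (hφ : ContinuousOn φ (Icc a b))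
    (hφ' : ∀ t ∈ Ico a b, HasDerivWithinAt φ (φ' t) (Ici t) t) (hb : φ b ≤ 0)
    (hpos : ∀ t ∈ Ico a b, 0 < φ t → 0 ≤ φ' t) : ∀ t ∈ Icc a b, φ t ≤ 0 := by
  intro t₁ ht₁
  by_contra h
  push Not at h
  set S : Set ℝ := Icc t₁ b ∩ φ ⁻¹' Iic 0 with hS
  have hSb : b ∈ S := ⟨right_mem_Icc.2 ht₁.2, hb⟩
  have hSne : S.Nonempty := ⟨b, hSb⟩
  have hSbdd : BddBelow S := ⟨t₁, fun t ht => ht.1.1⟩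
  have hScl : IsClosed S :=
    (hφ.mono (Icc_subset_Icc_left ht₁.1)).preimage_isClosed_of_isClosed isClosed_Icc isClosed_Iic
  set t₂ := sInf S with ht₂
  have ht₂S : t₂ ∈ S := hScl.csInf_mem hSne hSbdd
  have h12 : t₁ ≤ t₂ := ht₂S.1.1
  have ht₂b : t₂ ≤ b := ht₂S.1.2
  have hφ₂ : φ t₂ ≤ 0 := ht₂S.2
  have hposI : ∀ t ∈ Ico t₁ t₂, 0 < φ t := by
    intro t ht
    by_contra hle
    push Not at hle
    have htS : t ∈ S := ⟨⟨ht.1, ht.2.le.trans ht₂b⟩, hle⟩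
    exact absurd (csInf_le hSbdd htS) (not_le.2 ht.2)
  have hmono := image_le_of_deriv_right_le_deriv_boundary (f := fun t => φ t₁ - φ t)
    (f' := fun t => -φ' t) (a := t₁) (b := t₂) (B := fun _ => 0) (B' := fun _ => 0)
    (continuousOn_const.sub (hφ.mono (Icc_subset_Icc ht₁.1 ht₂b)))
    (fun t ht => (hφ' t ⟨ht₁.1.trans ht.1, ht.2.trans_le ht₂b⟩).const_sub (φ t₁))
    (by simp) continuousOn_const (fun t _ => hasDerivWithinAt_const _ _ _)
    (fun t ht => by
      have := hpos t ⟨ht₁.1.trans ht.1, ht.2.trans_le ht₂b⟩ (hposI t ht)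
      simpa using this)
  have := hmono (right_mem_Icc.2 h12)
  simp only [sub_nonpos] at this
  linarith

/-- **Forward no-crossing.** Let `φ` be continuous on `[a, b]` with a right derivative `φ' t` at
every `t ∈ [a, b)`, `φ a ≤ 0`, and `φ' t ≤ 0` whenever `φ t ≥ 0`. Then `φ ≤ 0` on `[a, b]`
(at the last time `t₀` with `φ t₀ ≤ 0` before a positive value `φ t₁ > 0` one has `φ t₀ = 0` by
continuity, and `φ` is non-increasing on `[t₀, t₁]`). Localised (first-exit) form of Hartman's
"`D_R v ≤ 0` on `[a, b]` implies `v(t) ≤ v(a)`". [cite: Hartman2002, Ch. III §4 Cor 4.1] -/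
theorem nonpos_of_deriv_right_forward (hφ : ContinuousOn φ (Icc a b))
    (hφ' : ∀ t ∈ Ico a b, HasDerivWithinAt φ (φ' t) (Ici t) t) (ha : φ a ≤ 0)
    (hnonneg : ∀ t ∈ Ico a b, 0 ≤ φ t → φ' t ≤ 0) : ∀ t ∈ Icc a b, φ t ≤ 0 := by
  intro t₁ ht₁
  by_contra h
  push Not at h
  set S : Set ℝ := Icc a t₁ ∩ φ ⁻¹' Iic 0 with hS
  have hSa : a ∈ S := ⟨left_mem_Icc.2 ht₁.1, ha⟩
  have hSne : S.Nonempty := ⟨a, hSa⟩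
  have hSbdd : BddAbove S := ⟨t₁, fun t ht => ht.1.2⟩
  have hScl : IsClosed S :=
    (hφ.mono (Icc_subset_Icc_right ht₁.2)).preimage_isClosed_of_isClosed isClosed_Icc isClosed_Iic
  set t₀ := sSup S with ht₀
  have ht₀S : t₀ ∈ S := hScl.csSup_mem hSne hSbdd
  have h01 : t₀ ≤ t₁ := ht₀S.1.2
  have hat₀ : a ≤ t₀ := ht₀S.1.1
  have hφ₀ : φ t₀ ≤ 0 := ht₀S.2
  have hposI : ∀ t ∈ Ioc t₀ t₁, 0 < φ t := by
    intro t ht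
    by_contra hle
    push Not at hle
    have htS : t ∈ S := ⟨⟨hat₀.trans ht.1.le, ht.2⟩, hle⟩
    exact absurd (le_csSup hSbdd htS) (not_le.2 ht.1)
  have h01' : t₀ < t₁ := lt_of_le_of_ne h01 (by rintro heq; rw [heq] at hφ₀; exact absurd hφ₀ (not_le.2 h))
  -- `φ t₀ = 0` by continuity from the right
  have hφ₀' : φ t₀ = 0 := by
    refine le_antisymm hφ₀ ?_
    have hcont : ContinuousWithinAt φ (Ioc t₀ t₁) t₀ :=
      (hφ t₀ ⟨hat₀, h01.trans ht₁.2⟩).mono fun t ht => ⟨hat₀.trans ht.1.le, ht.2.trans ht₁.2⟩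
    haveI : (𝓝[Ioc t₀ t₁] t₀).NeBot := by
      refine mem_closure_iff_nhdsWithin_neBot.1 ?_
      rw [closure_Ioc h01'.ne]
      exact left_mem_Icc.2 h01
    refine ge_of_tendsto hcont ?_
    filter_upwards [self_mem_nhdsWithin] with t ht using (hposI t ht).le
  have hmono := image_le_of_deriv_right_le_deriv_boundary (f := φ) (f' := φ') (a := t₀) (b := t₁)
    (B := fun _ => 0) (B' := fun _ => 0)
    (hφ.mono (Icc_subset_Icc hat₀ ht₁.2))
    (fun t ht => hφ' t ⟨hat₀.trans ht.1, ht.2.trans_le ht₁.2⟩)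
    (by simpa using hφ₀) continuousOn_const (fun t _ => hasDerivWithinAt_const _ _ _)
    (fun t ht => by
      refine hnonneg t ⟨hat₀.trans ht.1, ht.2.trans_le ht₁.2⟩ ?_
      rcases eq_or_lt_of_le ht.1 with heq | hlt
      · rw [← heq, hφ₀']
      · exact (hposI t ⟨hlt, ht.2.le⟩).le)
  have := hmono (right_mem_Icc.2 h01)
  exact absurd this (not_le.2 h)

end OneDim

/-! ## The coordinatewise clamp onto a box -/

section Clamp

variable {ι : Type*}

/-- The coordinatewise clamp ("projection") of `x : ι → ℝ` onto the box `[l, u]`: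
`(boxClamp l u x) i = max (l i) (min (x i) (u i))`. For `l ≤ u` it is a 1-Lipschitz (sup norm)
retraction of `ℝ^ι` onto `Set.Icc l u`. [folklore] -/
def boxClamp (l u x : ι → ℝ) : ι → ℝ := fun i => max (l i) (min (x i) (u i))

/-- Unfolding `boxClamp` at a coordinate. [folklore] -/
@[simp] private theorem boxClamp_apply (l u x : ι → ℝ) (i : ι) :
    boxClamp l u x i = max (l i) (min (x i) (u i)) := rfl

/-- The clamp lands in the box. [folklore] -/
private theorem boxClamp_mem_Icc {l u : ι → ℝ} (h : l ≤ u) (x : ι → ℝ) : boxClamp l u x ∈ Icc l u := by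
  refine ⟨fun i => le_max_left _ _, fun i => max_le (h i) (min_le_right _ _)⟩

/-- The clamp fixes the points of the box. [folklore] -/
private theorem boxClamp_of_mem {l u x : ι → ℝ} (hx : x ∈ Icc l u) : boxClamp l u x = x := by
  funext i
  simp [boxClamp, min_eq_left (hx.2 i), max_eq_right (hx.1 i)]

/-- Above the upper face the clamp sits ON the upper face. [folklore] -/
private theorem boxClamp_apply_of_le {l u x : ι → ℝ} (h : l ≤ u) {i : ι} (hi : u i ≤ x i) :
    boxClamp l u x i = u i := by
  simp [boxClamp, min_eq_right hi, max_eq_right (h i)]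

/-- Below the lower face the clamp sits ON the lower face. [folklore] -/
private theorem boxClamp_apply_of_ge {l u x : ι → ℝ} {i : ι} (hi : x i ≤ l i) :
    boxClamp l u x i = l i := by
  have : min (x i) (u i) ≤ l i := (min_le_left _ _).trans hi
  simp [boxClamp, max_eq_left this]

/-- One coordinate of the clamp is 1-Lipschitz. [folklore] -/
private theorem abs_boxClamp_sub_boxClamp_le (l u x y : ι → ℝ) (i : ι) :
    |boxClamp l u x i - boxClamp l u y i| ≤ |x i - y i| := by
  simp only [boxClamp_apply]
  calc |max (l i) (min (x i) (u i)) - max (l i) (min (y i) (u i))|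
      ≤ |min (x i) (u i) - min (y i) (u i)| := by
        rw [max_comm (l i), max_comm (l i)]
        exact abs_max_sub_max_le_abs _ _ _
    _ ≤ |x i - y i| := by
        have := abs_min_sub_min_le_max (x i) (u i) (y i) (u i)
        simpa using this

variable [Fintype ι]

/-- The clamp is 1-Lipschitz for the sup norm. [folklore] -/
private theorem dist_boxClamp_le (l u x y : ι → ℝ) : dist (boxClamp l u x) (boxClamp l u y) ≤ dist x y := by
  refine (dist_pi_le_iff dist_nonneg).2 fun i => ?_
  rw [Real.dist_eq]
  exact (abs_boxClamp_sub_boxClamp_le l u x y i).trans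
    (by rw [← Real.dist_eq]; exact dist_le_pi_dist x y i)

omit [Fintype ι] in
/-- Joint continuity of the clamp in `(l, u, x)` along continuous families. [folklore] -/
private theorem continuousOn_boxClamp {X : Type*} [TopologicalSpace X] {s : Set X} {l u x : X → ι → ℝ}
    (hl : ContinuousOn l s) (hu : ContinuousOn u s) (hx : ContinuousOn x s) :
    ContinuousOn (fun p => boxClamp (l p) (u p) (x p)) s := by
  refine continuousOn_pi.2 fun i => ?_
  have hl' : ContinuousOn (fun p => l p i) s := (continuous_apply i).comp_continuousOn hl
  have hu' : ContinuousOn (fun p => u p i) s := (continuous_apply i).comp_continuousOn hu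
  have hx' : ContinuousOn (fun p => x p i) s := (continuous_apply i).comp_continuousOn hx
  change ContinuousOn (fun p => l p i ⊔ (x p i ⊓ u p i)) s
  exact hl'.sup (hx'.inf hu')

end Clamp

/-! ## Trapped solutions in a moving box -/

section Box

variable {ι : Type*} [Fintype ι] {F : ℝ → (ι → ℝ) → ι → ℝ} {ℓ u ℓ' u' : ℝ → ι → ℝ} {a b : ℝ}
  {K : ℝ≥0}

/-- **Global solutions of the clamped system.** If `F` is jointly continuous on `[a, b] × ℝ^ι` and
`K`-Lipschitz in `x` on each box `[ℓ t, u t]` (`ℓ ≤ u` continuous), then for every `t₀ ∈ [a, b]`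
and every `x₀` the clamped system `x' = F(t, boxClamp (ℓ t) (u t) x)` has a solution on the whole
interval `[a, b]` with `x t₀ = x₀` (the clamped field is globally Lipschitz and bounded; Mathlib's
Picard–Lindelöf theorem on one large ball). [folklore] -/
private theorem exists_solution_clamped (hF : ContinuousOn (uncurry F) (Icc a b ×ˢ univ))
    (hK : ∀ t ∈ Icc a b, LipschitzOnWith K (F t) (Icc (ℓ t) (u t)))
    (hℓ : ContinuousOn ℓ (Icc a b)) (hu : ContinuousOn u (Icc a b)) (hle : ∀ t ∈ Icc a b, ℓ t ≤ u t)
    {t₀ : ℝ} (ht₀ : t₀ ∈ Icc a b) (x₀ : ι → ℝ) :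
    ∃ x : ℝ → ι → ℝ, x t₀ = x₀ ∧
      ∀ t ∈ Icc a b, HasDerivWithinAt x (F t (boxClamp (ℓ t) (u t) (x t))) (Icc a b) t := by
  -- a common bound `R₀` for the faces, hence for the boxes
  obtain ⟨Rℓ, hRℓ⟩ := isCompact_Icc.exists_bound_of_continuousOn hℓ
  obtain ⟨Ru, hRu⟩ := isCompact_Icc.exists_bound_of_continuousOn hu
  set R₀ := max Rℓ Ru with hR₀
  have hbox : ∀ t ∈ Icc a b, ∀ y ∈ Icc (ℓ t) (u t), y ∈ closedBall (0 : ι → ℝ) R₀ := by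
    intro t ht y hy
    rw [mem_closedBall, dist_zero_right, pi_norm_le_iff_of_nonneg
      ((norm_nonneg _).trans ((hRℓ t ht).trans (le_max_left _ _)))]
    intro i
    rw [Real.norm_eq_abs, abs_le]
    constructor
    · have h1 : -Rℓ ≤ ℓ t i := by
        have := (norm_le_pi_norm (ℓ t) i).trans (hRℓ t ht)
        rw [Real.norm_eq_abs] at this
        linarith [neg_abs_le (ℓ t i)]
      linarith [hy.1 i, le_max_left Rℓ Ru]
    · have h1 : u t i ≤ Ru := by
        have := (norm_le_pi_norm (u t) i).trans (hRu t ht)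
        rw [Real.norm_eq_abs] at this
        linarith [le_abs_self (u t i)]
      linarith [hy.2 i, le_max_right Rℓ Ru]
  -- a bound `L` for `F` on `[a, b] × closedBall 0 R₀`
  have hcpt : IsCompact (Icc a b ×ˢ closedBall (0 : ι → ℝ) R₀) :=
    isCompact_Icc.prod (isCompact_closedBall _ _)
  obtain ⟨C, hC⟩ := hcpt.exists_bound_of_continuousOn (hF.mono (prod_mono le_rfl (subset_univ _)))
  set L : ℝ≥0 := Real.toNNReal C with hL
  -- the clamped field
  set G : ℝ → (ι → ℝ) → ι → ℝ := fun t x => F t (boxClamp (ℓ t) (u t) x) with hG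
  have hGval : ∀ t ∈ Icc a b, ∀ x, ‖G t x‖ ≤ L := by
    intro t ht x
    have hmem : (t, boxClamp (ℓ t) (u t) x) ∈ Icc a b ×ˢ closedBall (0 : ι → ℝ) R₀ :=
      ⟨ht, hbox t ht _ (boxClamp_mem_Icc (hle t ht) x)⟩
    exact (hC _ hmem).trans (Real.le_coe_toNNReal C)
  have hGlip : ∀ t ∈ Icc a b, LipschitzWith K (G t) := by
    intro t ht
    refine LipschitzWith.of_dist_le_mul fun x y => ?_
    have h1 := (hK t ht).dist_le_mul _ (boxClamp_mem_Icc (hle t ht) x) _ (boxClamp_mem_Icc (hle t ht) y)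
    exact h1.trans (mul_le_mul_of_nonneg_left (dist_boxClamp_le _ _ x y) K.2)
  have hGcont : ∀ x, ContinuousOn (fun t => G t x) (Icc a b) := by
    intro x
    have h1 : ContinuousOn (fun t => (t, boxClamp (ℓ t) (u t) x)) (Icc a b) :=
      continuousOn_id.prodMk (continuousOn_boxClamp hℓ hu continuousOn_const)
    refine (hF.comp h1 ?_).congr fun t _ => rfl
    intro t ht
    exact ⟨ht, mem_univ _⟩
  -- Picard–Lindelöf on the ball of radius `L * (b - a)` about `x₀`
  have hab : a ≤ b := ht₀.1.trans ht₀.2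
  set t₀' : Icc a b := ⟨t₀, ht₀⟩
  have hPL : IsPicardLindelof G t₀' x₀ (L * Real.toNNReal (b - a)) 0 L K := by
    refine ⟨fun t ht => (hGlip t ht).lipschitzOnWith, fun x _ => hGcont x,
      fun t ht x _ => hGval t ht x, ?_⟩
    rw [NNReal.coe_zero, sub_zero, NNReal.coe_mul, Real.coe_toNNReal _ (sub_nonneg.2 hab)]
    refine mul_le_mul_of_nonneg_left ?_ L.2
    exact max_le (by simp only [t₀']; linarith [ht₀.1]) (by simp only [t₀']; linarith [ht₀.2])
  obtain ⟨x, hx₀, hx⟩ := hPL.exists_eq_forall_mem_Icc_hasDerivWithinAt₀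
  exact ⟨x, hx₀, hx⟩

/-- A solution on `[a, b]` has a right derivative at every `t ∈ [a, b)` (restatement of the
within-`Icc` derivative). [folklore] -/
private theorem hasDerivWithinAt_Ici_of_mem_Ico {E : Type*} [NormedAddCommGroup E] [NormedSpace ℝ E]
    {x : ℝ → E} {v : E} {t : ℝ} (h : HasDerivWithinAt x v (Icc a b) t) (ht : t ∈ Ico a b) :
    HasDerivWithinAt x v (Ici t) t :=
  h.mono_of_mem_nhdsWithin (mem_of_superset (Icc_mem_nhdsGE ht.2) (Icc_subset_Icc_left ht.1))

/-- **Backward trapping of a clamped solution.** Let `x` solve the clamped system on `[a, b]` with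
`x b` in the box, the faces having right derivatives `ℓ'`, `u'` on `[a, b)`. If on the upper face
`u' t i ≤ F t y i` and on the lower face `F t y i ≤ ℓ' t i` (for `y` in the box `[ℓ t, u t]` with
`y i = u t i`, resp. `y i = ℓ t i`, `t ∈ [a, b)`), then `x t ∈ [ℓ t, u t]` for all `t ∈ [a, b]`.
[cite: Deimling1977, §5.2 Thm 5.1–5.2 pp. 67–68] -/
theorem mem_Icc_of_clamped_backward {x : ℝ → ι → ℝ}
    (hx : ∀ t ∈ Icc a b, HasDerivWithinAt x (F t (boxClamp (ℓ t) (u t) (x t))) (Icc a b) t)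
    (hℓ : ContinuousOn ℓ (Icc a b)) (hu : ContinuousOn u (Icc a b)) (hle : ∀ t ∈ Icc a b, ℓ t ≤ u t)
    (hℓ' : ∀ t ∈ Ico a b, HasDerivWithinAt ℓ (ℓ' t) (Ici t) t)
    (hu' : ∀ t ∈ Ico a b, HasDerivWithinAt u (u' t) (Ici t) t)
    (htop : ∀ t ∈ Ico a b, ∀ y ∈ Icc (ℓ t) (u t), ∀ i, y i = u t i → u' t i ≤ F t y i)
    (hbot : ∀ t ∈ Ico a b, ∀ y ∈ Icc (ℓ t) (u t), ∀ i, y i = ℓ t i → F t y i ≤ ℓ' t i)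
    (hxb : x b ∈ Icc (ℓ b) (u b)) : ∀ t ∈ Icc a b, x t ∈ Icc (ℓ t) (u t) := by
  have hxc : ContinuousOn x (Icc a b) := fun t ht => (hx t ht).continuousWithinAt
  intro t ht
  constructor
  · -- lower face: `φ = ℓ i - x i`
    intro i
    have key := nonpos_of_deriv_right_backward (φ := fun s => ℓ s i - x s i)
      (φ' := fun s => ℓ' s i - F s (boxClamp (ℓ s) (u s) (x s)) i) (a := a) (b := b)
      (((continuous_apply i).comp_continuousOn hℓ).sub ((continuous_apply i).comp_continuousOn hxc))
      (fun s hs => ((hasDerivWithinAt_pi.1 (hℓ' s hs) i).sub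
        (hasDerivWithinAt_pi.1 (hasDerivWithinAt_Ici_of_mem_Ico (hx s (Ico_subset_Icc_self hs)) hs) i)))
      (by simpa using hxb.1 i)
      (fun s hs hφ => by
        have hxi : x s i ≤ ℓ s i := by linarith
        have hface := boxClamp_apply_of_ge (u := u s) hxi
        have := hbot s hs _ (boxClamp_mem_Icc (hle s (Ico_subset_Icc_self hs)) (x s)) i hface
        simp only [sub_nonneg]
        exact this)
      t ht
    simp only [sub_nonpos] at key
    exact key
  · -- upper face: `φ = x i - u i`
    intro i
    have key := nonpos_of_deriv_right_backward (φ := fun s => x s i - u s i)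
      (φ' := fun s => F s (boxClamp (ℓ s) (u s) (x s)) i - u' s i) (a := a) (b := b)
      (((continuous_apply i).comp_continuousOn hxc).sub ((continuous_apply i).comp_continuousOn hu))
      (fun s hs => ((hasDerivWithinAt_pi.1
        (hasDerivWithinAt_Ici_of_mem_Ico (hx s (Ico_subset_Icc_self hs)) hs) i).sub
        (hasDerivWithinAt_pi.1 (hu' s hs) i)))
      (by simpa using hxb.2 i)
      (fun s hs hφ => by
        have hxi : u s i ≤ x s i := by linarith
        have hface := boxClamp_apply_of_le (hle s (Ico_subset_Icc_self hs)) hxi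
        have := htop s hs _ (boxClamp_mem_Icc (hle s (Ico_subset_Icc_self hs)) (x s)) i hface
        simp only [sub_nonneg]
        exact this)
      t ht
    simp only [sub_nonpos] at key
    exact key

/-- **Forward trapping of a clamped solution** (Müller's face conditions): `x a` in the box,
`F t y i ≤ u' t i` on the upper face and `ℓ' t i ≤ F t y i` on the lower face imply
`x t ∈ [ℓ t, u t]` on `[a, b]`. [cite: Deimling1977, §5.2 Thm 5.1–5.2 pp. 67–68] -/
theorem mem_Icc_of_clamped_forward {x : ℝ → ι → ℝ}
    (hx : ∀ t ∈ Icc a b, HasDerivWithinAt x (F t (boxClamp (ℓ t) (u t) (x t))) (Icc a b) t)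
    (hℓ : ContinuousOn ℓ (Icc a b)) (hu : ContinuousOn u (Icc a b)) (hle : ∀ t ∈ Icc a b, ℓ t ≤ u t)
    (hℓ' : ∀ t ∈ Ico a b, HasDerivWithinAt ℓ (ℓ' t) (Ici t) t)
    (hu' : ∀ t ∈ Ico a b, HasDerivWithinAt u (u' t) (Ici t) t)
    (htop : ∀ t ∈ Ico a b, ∀ y ∈ Icc (ℓ t) (u t), ∀ i, y i = u t i → F t y i ≤ u' t i)
    (hbot : ∀ t ∈ Ico a b, ∀ y ∈ Icc (ℓ t) (u t), ∀ i, y i = ℓ t i → ℓ' t i ≤ F t y i)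
    (hxa : x a ∈ Icc (ℓ a) (u a)) : ∀ t ∈ Icc a b, x t ∈ Icc (ℓ t) (u t) := by
  have hxc : ContinuousOn x (Icc a b) := fun t ht => (hx t ht).continuousWithinAt
  intro t ht
  constructor
  · intro i
    have key := nonpos_of_deriv_right_forward (φ := fun s => ℓ s i - x s i)
      (φ' := fun s => ℓ' s i - F s (boxClamp (ℓ s) (u s) (x s)) i) (a := a) (b := b)
      (((continuous_apply i).comp_continuousOn hℓ).sub ((continuous_apply i).comp_continuousOn hxc))
      (fun s hs => ((hasDerivWithinAt_pi.1 (hℓ' s hs) i).sub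
        (hasDerivWithinAt_pi.1 (hasDerivWithinAt_Ici_of_mem_Ico (hx s (Ico_subset_Icc_self hs)) hs) i)))
      (by simpa using hxa.1 i)
      (fun s hs hφ => by
        have hxi : x s i ≤ ℓ s i := by linarith
        have hface := boxClamp_apply_of_ge (u := u s) hxi
        have := hbot s hs _ (boxClamp_mem_Icc (hle s (Ico_subset_Icc_self hs)) (x s)) i hface
        simp only [sub_nonpos]
        exact this)
      t ht
    simp only [sub_nonpos] at key
    exact key
  · intro i
    have key := nonpos_of_deriv_right_forward (φ := fun s => x s i - u s i)
      (φ' := fun s => F s (boxClamp (ℓ s) (u s) (x s)) i - u' s i) (a := a) (b := b)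
      (((continuous_apply i).comp_continuousOn hxc).sub ((continuous_apply i).comp_continuousOn hu))
      (fun s hs => ((hasDerivWithinAt_pi.1
        (hasDerivWithinAt_Ici_of_mem_Ico (hx s (Ico_subset_Icc_self hs)) hs) i).sub
        (hasDerivWithinAt_pi.1 (hu' s hs) i)))
      (by simpa using hxa.2 i)
      (fun s hs hφ => by
        have hxi : u s i ≤ x s i := by linarith
        have hface := boxClamp_apply_of_le (hle s (Ico_subset_Icc_self hs)) hxi
        have := htop s hs _ (boxClamp_mem_Icc (hle s (Ico_subset_Icc_self hs)) (x s)) i hface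
        simp only [sub_nonpos]
        exact this)
      t ht
    simp only [sub_nonpos] at key
    exact key

/-- **Trapped backward solutions (existence).** `F` jointly continuous on `[a, b] × ℝ^ι` and
`K`-Lipschitz on the boxes; faces `ℓ ≤ u` continuous on `[a, b]` with right derivatives `ℓ'`, `u'`
on `[a, b)`; face conditions `u' t i ≤ F t y i` at points `y` of the box on the upper face
`y i = u t i` and `F t y i ≤ ℓ' t i` on the lower face. Then for every terminal value
`xb ∈ [ℓ b, u b]` the system `x' = F(t, x)` has a solution on `[a, b]` with `x b = xb` that stays
in the moving box: `x t ∈ [ℓ t, u t]` for all `t ∈ [a, b]`. (The trapping step of backward-in-time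
shell-model constructions: barriers `η_k ≤ x_k ≤ ζ_k`, "on `x_k = ζ_k` one has `x_k' ≥ ζ_k'`, on
`x_k = η_k` one has `x_k' ≤ η_k'`".) [cite: Deimling1977, §5.2 Thm 5.1–5.2 pp. 67–68] -/
theorem exists_solution_mem_Icc_of_face_backward (hF : ContinuousOn (uncurry F) (Icc a b ×ˢ univ))
    (hK : ∀ t ∈ Icc a b, LipschitzOnWith K (F t) (Icc (ℓ t) (u t)))
    (hℓ : ContinuousOn ℓ (Icc a b)) (hu : ContinuousOn u (Icc a b)) (hle : ∀ t ∈ Icc a b, ℓ t ≤ u t)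
    (hℓ' : ∀ t ∈ Ico a b, HasDerivWithinAt ℓ (ℓ' t) (Ici t) t)
    (hu' : ∀ t ∈ Ico a b, HasDerivWithinAt u (u' t) (Ici t) t)
    (htop : ∀ t ∈ Ico a b, ∀ y ∈ Icc (ℓ t) (u t), ∀ i, y i = u t i → u' t i ≤ F t y i)
    (hbot : ∀ t ∈ Ico a b, ∀ y ∈ Icc (ℓ t) (u t), ∀ i, y i = ℓ t i → F t y i ≤ ℓ' t i)
    (hab : a ≤ b) {xb : ι → ℝ} (hxb : xb ∈ Icc (ℓ b) (u b)) :
    ∃ x : ℝ → ι → ℝ, x b = xb ∧ (∀ t ∈ Icc a b, HasDerivWithinAt x (F t (x t)) (Icc a b) t) ∧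
      ∀ t ∈ Icc a b, x t ∈ Icc (ℓ t) (u t) := by
  obtain ⟨x, hx₀, hx⟩ := exists_solution_clamped hF hK hℓ hu hle (right_mem_Icc.2 hab) xb
  have hmem := mem_Icc_of_clamped_backward hx hℓ hu hle hℓ' hu' htop hbot (hx₀.symm ▸ hxb)
  refine ⟨x, hx₀, fun t ht => ?_, hmem⟩
  have := hx t ht
  rwa [boxClamp_of_mem (hmem t ht)] at this

/-- **Trapped forward solutions (existence; Müller's face conditions).** As
`exists_solution_mem_Icc_of_face_backward` with initial data `xa ∈ [ℓ a, u a]` and the forward face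
conditions `F t y i ≤ u' t i` (upper face), `ℓ' t i ≤ F t y i` (lower face).
[cite: Deimling1977, §5.2 Thm 5.1–5.2 pp. 67–68] -/
theorem exists_solution_mem_Icc_of_face_forward (hF : ContinuousOn (uncurry F) (Icc a b ×ˢ univ))
    (hK : ∀ t ∈ Icc a b, LipschitzOnWith K (F t) (Icc (ℓ t) (u t)))
    (hℓ : ContinuousOn ℓ (Icc a b)) (hu : ContinuousOn u (Icc a b)) (hle : ∀ t ∈ Icc a b, ℓ t ≤ u t)
    (hℓ' : ∀ t ∈ Ico a b, HasDerivWithinAt ℓ (ℓ' t) (Ici t) t)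
    (hu' : ∀ t ∈ Ico a b, HasDerivWithinAt u (u' t) (Ici t) t)
    (htop : ∀ t ∈ Ico a b, ∀ y ∈ Icc (ℓ t) (u t), ∀ i, y i = u t i → F t y i ≤ u' t i)
    (hbot : ∀ t ∈ Ico a b, ∀ y ∈ Icc (ℓ t) (u t), ∀ i, y i = ℓ t i → ℓ' t i ≤ F t y i)
    (hab : a ≤ b) {xa : ι → ℝ} (hxa : xa ∈ Icc (ℓ a) (u a)) :
    ∃ x : ℝ → ι → ℝ, x a = xa ∧ (∀ t ∈ Icc a b, HasDerivWithinAt x (F t (x t)) (Icc a b) t) ∧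
      ∀ t ∈ Icc a b, x t ∈ Icc (ℓ t) (u t) := by
  obtain ⟨x, hx₀, hx⟩ := exists_solution_clamped hF hK hℓ hu hle (left_mem_Icc.2 hab) xa
  have hmem := mem_Icc_of_clamped_forward hx hℓ hu hle hℓ' hu' htop hbot (hx₀.symm ▸ hxa)
  refine ⟨x, hx₀, fun t ht => ?_, hmem⟩
  have := hx t ht
  rwa [boxClamp_of_mem (hmem t ht)] at this

end Box

/-! ## Smooth fields: the Lipschitz hypothesis discharged

For a field that is jointly `C¹` in `(t, x)` on `ℝ × ℝ^ι` — e.g. any polynomial in the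
coordinates with `C¹` time-dependent coefficients, as in shell models — the hypotheses `hF`, `hK`
of the theorems above hold automatically (mean value inequality on the compact convex set
`[a, b] × B̄(0, R₀)` containing all the boxes, Mathlib's `ContDiffOn.exists_lipschitzOnWith`). -/

section Smooth

variable {ι : Type*} [Fintype ι] {F : ℝ → (ι → ℝ) → ι → ℝ} {ℓ u ℓ' u' : ℝ → ι → ℝ} {a b : ℝ}

/-- All boxes `[ℓ t, u t]`, `t ∈ [a, b]`, lie in one closed ball (continuity of the faces on the
compact interval). [folklore] -/
private theorem exists_Icc_subset_closedBall (hℓ : ContinuousOn ℓ (Icc a b))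
    (hu : ContinuousOn u (Icc a b)) :
    ∃ R₀ : ℝ, ∀ t ∈ Icc a b, Icc (ℓ t) (u t) ⊆ closedBall (0 : ι → ℝ) R₀ := by
  obtain ⟨Rℓ, hRℓ⟩ := isCompact_Icc.exists_bound_of_continuousOn hℓ
  obtain ⟨Ru, hRu⟩ := isCompact_Icc.exists_bound_of_continuousOn hu
  refine ⟨max Rℓ Ru, fun t ht y hy => ?_⟩
  rw [mem_closedBall, dist_zero_right, pi_norm_le_iff_of_nonneg
    ((norm_nonneg _).trans ((hRℓ t ht).trans (le_max_left _ _)))]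
  intro i
  rw [Real.norm_eq_abs, abs_le]
  constructor
  · have h1 : -Rℓ ≤ ℓ t i := by
      have := (norm_le_pi_norm (ℓ t) i).trans (hRℓ t ht)
      rw [Real.norm_eq_abs] at this
      linarith [neg_abs_le (ℓ t i)]
    linarith [hy.1 i, le_max_left Rℓ Ru]
  · have h1 : u t i ≤ Ru := by
      have := (norm_le_pi_norm (u t) i).trans (hRu t ht)
      rw [Real.norm_eq_abs] at this
      linarith [le_abs_self (u t i)]
    linarith [hy.2 i, le_max_right Rℓ Ru]

/-- A jointly `C¹` field is Lipschitz in `x` on the boxes `[ℓ t, u t]`, uniformly in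
`t ∈ [a, b]` (one constant; mean value inequality on `[a, b] × B̄(0, R₀)`). [folklore] -/
private theorem exists_lipschitzOnWith_Icc_of_contDiff (hF : ContDiff ℝ 1 (uncurry F))
    (hℓ : ContinuousOn ℓ (Icc a b)) (hu : ContinuousOn u (Icc a b)) :
    ∃ K : ℝ≥0, ∀ t ∈ Icc a b, LipschitzOnWith K (F t) (Icc (ℓ t) (u t)) := by
  obtain ⟨R₀, hR₀⟩ := exists_Icc_subset_closedBall hℓ hu
  have hS : IsCompact (Icc a b ×ˢ closedBall (0 : ι → ℝ) R₀) :=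
    isCompact_Icc.prod (isCompact_closedBall _ _)
  have hSc : Convex ℝ (Icc a b ×ˢ closedBall (0 : ι → ℝ) R₀) :=
    (convex_Icc a b).prod (convex_closedBall _ _)
  obtain ⟨K, hK⟩ := (hF.contDiffOn (s := Icc a b ×ˢ closedBall (0 : ι → ℝ) R₀)).exists_lipschitzOnWith
    one_ne_zero hSc hS
  refine ⟨K, fun t ht => LipschitzOnWith.of_dist_le_mul fun x hx y hy => ?_⟩
  have h := hK.dist_le_mul (t, x) ⟨ht, hR₀ t ht hx⟩ (t, y) ⟨ht, hR₀ t ht hy⟩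
  have hd : dist (t, x) (t, y) = dist x y := by
    rw [Prod.dist_eq, dist_self, max_eq_right dist_nonneg]
  simpa [uncurry, hd] using h

/-- **Trapped backward solutions for a smooth field.** `exists_solution_mem_Icc_of_face_backward`
for a field jointly `C¹` in `(t, x)` (the continuity and Lipschitz hypotheses are then automatic):
faces `ℓ ≤ u` continuous on `[a, b]` with right derivatives on `[a, b)`, backward face conditions
`u' t i ≤ F t y i` (upper face), `F t y i ≤ ℓ' t i` (lower face) at box points; every terminal value
in `[ℓ b, u b]` is attained by a solution on `[a, b]` staying in the moving box.
[cite: Deimling1977, §5.2 Thm 5.1–5.2 pp. 67–68] -/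
theorem exists_solution_mem_Icc_of_face_backward_of_contDiff (hF : ContDiff ℝ 1 (uncurry F))
    (hℓ : ContinuousOn ℓ (Icc a b)) (hu : ContinuousOn u (Icc a b)) (hle : ∀ t ∈ Icc a b, ℓ t ≤ u t)
    (hℓ' : ∀ t ∈ Ico a b, HasDerivWithinAt ℓ (ℓ' t) (Ici t) t)
    (hu' : ∀ t ∈ Ico a b, HasDerivWithinAt u (u' t) (Ici t) t)
    (htop : ∀ t ∈ Ico a b, ∀ y ∈ Icc (ℓ t) (u t), ∀ i, y i = u t i → u' t i ≤ F t y i)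
    (hbot : ∀ t ∈ Ico a b, ∀ y ∈ Icc (ℓ t) (u t), ∀ i, y i = ℓ t i → F t y i ≤ ℓ' t i)
    (hab : a ≤ b) {xb : ι → ℝ} (hxb : xb ∈ Icc (ℓ b) (u b)) :
    ∃ x : ℝ → ι → ℝ, x b = xb ∧ (∀ t ∈ Icc a b, HasDerivWithinAt x (F t (x t)) (Icc a b) t) ∧
      ∀ t ∈ Icc a b, x t ∈ Icc (ℓ t) (u t) := by
  obtain ⟨K, hK⟩ := exists_lipschitzOnWith_Icc_of_contDiff hF hℓ hu
  exact exists_solution_mem_Icc_of_face_backward (K := K) hF.continuous.continuousOn hK hℓ hu hle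
    hℓ' hu' htop hbot hab hxb

/-- **Trapped forward solutions for a smooth field** (Müller's conditions):
`exists_solution_mem_Icc_of_face_forward` for a field jointly `C¹` in `(t, x)`.
[cite: Deimling1977, §5.2 Thm 5.1–5.2 pp. 67–68] -/
theorem exists_solution_mem_Icc_of_face_forward_of_contDiff (hF : ContDiff ℝ 1 (uncurry F))
    (hℓ : ContinuousOn ℓ (Icc a b)) (hu : ContinuousOn u (Icc a b)) (hle : ∀ t ∈ Icc a b, ℓ t ≤ u t)
    (hℓ' : ∀ t ∈ Ico a b, HasDerivWithinAt ℓ (ℓ' t) (Ici t) t)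
    (hu' : ∀ t ∈ Ico a b, HasDerivWithinAt u (u' t) (Ici t) t)
    (htop : ∀ t ∈ Ico a b, ∀ y ∈ Icc (ℓ t) (u t), ∀ i, y i = u t i → F t y i ≤ u' t i)
    (hbot : ∀ t ∈ Ico a b, ∀ y ∈ Icc (ℓ t) (u t), ∀ i, y i = ℓ t i → ℓ' t i ≤ F t y i)
    (hab : a ≤ b) {xa : ι → ℝ} (hxa : xa ∈ Icc (ℓ a) (u a)) :
    ∃ x : ℝ → ι → ℝ, x a = xa ∧ (∀ t ∈ Icc a b, HasDerivWithinAt x (F t (x t)) (Icc a b) t) ∧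
      ∀ t ∈ Icc a b, x t ∈ Icc (ℓ t) (u t) := by
  obtain ⟨K, hK⟩ := exists_lipschitzOnWith_Icc_of_contDiff hF hℓ hu
  exact exists_solution_mem_Icc_of_face_forward (K := K) hF.continuous.continuousOn hK hℓ hu hle
    hℓ' hu' htop hbot hab hxa

end Smooth

end Literature.Analysis.ODE
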